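import Mathlib
import Summits.NavierStokesRegularity.NavierStokesRegularity.Theorems.TaoLadderRungTwoFlatAheadCuts
import HarnessLib

/-!
# THE PER-FLOW CUT STEP (ahead tail energy induction along ONE flow, hull on a sub-horizon `[0, t₀]`)
  (helper for the K_A♭ parent item stmt-NavierStokesRegularity-22987 `FlatGapCertificatesV2`, route TaoLadderRungTwoFlat;
  cell harvest/h2-tao-ladder, p1 g25; the per-flow form of `HopTube.aheadCutStep` (…AheadCutStep, cell LADDER §62) needed by the
  interface bootstrap of `…ConditionalBlock` (theory-1 g54 CAPTURE-E2-70, ask A70-3))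

* `aheadCutStep_flow` — ONE exact graded-mirror pseudo-flow on `[0, τ]`, a hull `|S₁(j, ·)| ≤ V` on `[0, t₀]` (`t₀ ≤ τ`,
  `t₀ ≤ c₀`), the initial tail `Σ_{m>j} Σᵢ S₀(i,m)² ≤ G²` and the closing inequality `(4/3)c₀·clock_j·V(V + 2εG) < G` give
  `|S_{im}| ≤ 2G` beyond `j` on `[0, t₀]` — the proof of `aheadCutStep` verbatim at horizon `t₀` (the class-level statement
  `AheadCutStepTarget` cannot be instantiated on one flow mid-bootstrap, hence this restatement).

HONEST FRAMING: one energy estimate over MODEL-lattice certificate flows (graded mirror table on `S♭`); nothing certified; no item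
closed; nothing about the Navier–Stokes equations.
-/

noncomputable section

-- the sub-problem namespace repeats the summit name by design (D-0017)
set_option linter.dupNamespace false

namespace Summit.NavierStokesRegularity.NavierStokesRegularity.Theorems.HopTube

open Set Finset Literature.Analysis.FluidPDE Literature.Analysis.FluidPDE.TaoCascade MirrorPulse

section Flow

variable {ε ε₀ τ κ₂ : ℝ} {S₀ F₀ B₀ : Fin 2 → ℤ → ℝ} {S F : Fin 2 → ℤ → ℝ → ℝ}

set_option maxHeartbeats 400000 in
/-- **THE PER-FLOW CUT STEP.** Along ONE exact graded-mirror pseudo-flow on `[0, τ]`: a hull `|S₁(j, s)| ≤ V` on `[0, t₀]`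
(`0 ≤ t₀ ≤ τ`, `t₀ ≤ c₀`), the initial tail energy `Σ_{m∈N} Σᵢ S₀(i,m)² ≤ G²` (finite `N ⊆ (j, ∞)`) and the closing inequality at
horizon `c₀` give the cut envelope `|S_{im}(s)| ≤ 2G` for `m > j`, `s ∈ [0, t₀]`. (The proof of `aheadCutStep` verbatim at horizon `t₀`.)
[cite: Tao2016AveragedNS, §4 (4.3), Lemma 4.1 (4.5), §5 (continuity argument), §6.2 Prop. 6.3 (ix) (statement shape); cell LADDER §62 (AHEAD-TAIL-62), §70 (A70-3)] -/
theorem aheadCutStep_flow (hflow : PseudoFlowOnShift shiftSetFlat τ ε₀ (mirrorTable ε ε) 0 κ₂ S₀ F₀ B₀ S F)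
    (hε : 0 ≤ ε) (hε₀ : 0 < ε₀) {t₀ c₀ : ℝ} (ht₀ : 0 ≤ t₀) (ht₀τ : t₀ ≤ τ) (ht₀c : t₀ ≤ c₀) {j : ℤ} {V G : ℝ}
    (hV : 0 ≤ V) (hG : 0 ≤ G) (hVb : ∀ s ∈ Icc 0 t₀, |S 1 j s| ≤ V)
    (hinit : ∀ N : Finset ℤ, (∀ m ∈ N, j < m) → ∑ m ∈ N, ∑ i : Fin 2, S₀ i m ^ 2 ≤ G ^ 2)
    (hclose : 4 / 3 * c₀ * clock ε₀ j * V * (V + 2 * ε * G) < G) :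
    ∀ t ∈ Icc 0 t₀, ∀ (i : Fin 2) (m : ℤ), j < m → |S i m t| ≤ 2 * G := by
  intro t ht i m hm
  have hε₀' : (-1 : ℝ) ≤ ε₀ := by linarith
  have hcj : 0 ≤ clock ε₀ j := clock_nonneg hε₀' j
  have hclose' : 4 / 3 * t₀ * clock ε₀ j * V * (V + 2 * ε * G) < G := by
    have h1 : 0 ≤ clock ε₀ j * V * (V + 2 * ε * G) := by positivity
    have : 4 / 3 * t₀ * clock ε₀ j * V * (V + 2 * ε * G) ≤ 4 / 3 * c₀ * clock ε₀ j * V * (V + 2 * ε * G) := by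
      have e1 : 4 / 3 * t₀ * clock ε₀ j * V * (V + 2 * ε * G) = 4 / 3 * t₀ * (clock ε₀ j * V * (V + 2 * ε * G)) := by ring
      have e2 : 4 / 3 * c₀ * clock ε₀ j * V * (V + 2 * ε * G) = 4 / 3 * c₀ * (clock ε₀ j * V * (V + 2 * ε * G)) := by ring
      rw [e1, e2]; exact mul_le_mul_of_nonneg_right (by linarith) h1
    linarith
  -- the flux bound at the cut and the strict margin
  set D₁ : ℝ := clock ε₀ j * V * (2 * G) * (V + ε * (2 * G)) with hD₁
  have hD₁0 : 0 ≤ D₁ := by positivity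
  have hmargin : G ^ 2 + 2 * t₀ * D₁ < 4 * G ^ 2 := by
    have hGpos : 0 < G := by
      rcases eq_or_lt_of_le hG with h0 | hpos
      · exfalso
        rw [← h0] at hclose'
        have : 0 ≤ 4 / 3 * t₀ * clock ε₀ j * V * (V + 2 * ε * 0) := by positivity
        linarith
      · exact hpos
    have h3 := mul_lt_mul_of_pos_right hclose' (by positivity : (0 : ℝ) < 3 * G)
    have e : 4 / 3 * t₀ * clock ε₀ j * V * (V + 2 * ε * G) * (3 * G) = 2 * t₀ * D₁ := by rw [hD₁]; ring
    nlinarith [h3, e]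
  -- the far-flux slack
  set η : ℝ := (4 * G ^ 2 - (G ^ 2 + 2 * t₀ * D₁)) / (2 * (t₀ + 1)) with hη
  have hη0 : 0 < η := by rw [hη]; exact div_pos (by linarith) (by positivity)
  have hb : G ^ 2 + 2 * t₀ * (D₁ + η) < 4 * G ^ 2 := by
    have hc1 : 2 * t₀ * η ≤ t₀ / (t₀ + 1) * (4 * G ^ 2 - (G ^ 2 + 2 * t₀ * D₁)) := by
      rw [hη]; apply le_of_eq; field_simp
    have hc2 : t₀ / (t₀ + 1) < 1 := by rw [div_lt_one (by positivity)]; linarith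
    have hpos : 0 < 4 * G ^ 2 - (G ^ 2 + 2 * t₀ * D₁) := by linarith
    have hc3 : t₀ / (t₀ + 1) * (4 * G ^ 2 - (G ^ 2 + 2 * t₀ * D₁)) < 1 * (4 * G ^ 2 - (G ^ 2 + 2 * t₀ * D₁)) :=
      mul_lt_mul_of_pos_right hc2 hpos
    nlinarith [hc1, hc3]
  -- the number of shells: far flux below `η`, and the shell `m` inside
  obtain ⟨L₀, hL₀⟩ := fluxT_far_small hflow hε hε₀ j hη0
  set L : ℕ := max L₀ (m - j).toNat with hL
  have hLL₀ : L₀ ≤ L := le_max_left _ _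
  have hmL : (m - j).toNat ≤ L := le_max_right _ _
  have hmj : ((m - j).toNat : ℤ) = m - j := Int.toNat_of_nonneg (by omega)
  have hL1 : 1 ≤ L := by
    have : 1 ≤ (m - j).toNat := by omega
    exact this.trans hmL
  -- the partial tail energy and its size
  set E : ℝ → ℝ := fun x => ∑ l ∈ Finset.range L, (S 0 (j + 1 + l) x ^ 2 + S 1 (j + 1 + l) x ^ 2) / 2 with hE
  have hsub : Icc 0 t₀ ⊆ Icc 0 τ := Icc_subset_Icc le_rfl ht₀τ
  have hEcont : ContinuousOn (fun x => 2 * E x) (Icc 0 t₀) := by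
    refine ContinuousOn.mul continuousOn_const ?_
    refine continuousOn_finsetSum _ fun l _ => ?_
    have h0 := (QuadPolar.continuousOn_of_pseudoFlowOnShift hflow 0 (j + 1 + l)).mono hsub
    have h1 := (QuadPolar.continuousOn_of_pseudoFlowOnShift hflow 1 (j + 1 + l)).mono hsub
    exact ((h0.pow 2).add (h1.pow 2)).div_const 2
  have hE0 : 2 * E 0 ≤ G ^ 2 := by
    have hinj : Set.InjOn (fun l : ℕ => j + 1 + (l : ℤ)) ↑(Finset.range L) := by
      intro a _ b _ hab; simpa using hab
    have hN := hinit ((Finset.range L).image fun l : ℕ => j + 1 + (l : ℤ)) (by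
      intro m' hm'
      obtain ⟨l, -, rfl⟩ := Finset.mem_image.mp hm'
      omega)
    rw [Finset.sum_image hinj] at hN
    have e : 2 * E 0 = ∑ l ∈ Finset.range L, ∑ i : Fin 2, S₀ i (j + 1 + l) ^ 2 := by
      rw [hE]; dsimp only
      rw [Finset.mul_sum]
      refine Finset.sum_congr rfl fun l _ => ?_
      rw [Fin.sum_univ_two, hflow.init_S 0, hflow.init_S 1]; ring
    rw [e]; exact hN
  -- derivative of `E` within `[0, t₀]`
  have hEder : ∀ x ∈ Icc 0 t₀, HasDerivWithinAt E (fluxT ε ε₀ S j x - fluxT ε ε₀ S (j + L) x) (Icc 0 t₀) x :=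
    fun x hx => (partialTail_hasDerivWithinAt hflow j L (hsub hx)).mono hsub
  -- the bootstrap on `2E`
  have key := Bootstrap.Icc_induction (f := fun x => 2 * E x) (T := t₀) (a := 4 * G ^ 2)
    (b := G ^ 2 + 2 * t₀ * (D₁ + η)) ht₀ hEcont hb (hE0.trans (by nlinarith [hD₁0, hη0.le, ht₀])) ?_
  · -- conclusion: the shell `m` is the term `l₀ = m − j − 1 < L`
    have hft := key t ht
    set l₀ : ℕ := (m - j - 1).toNat with hl₀
    have hl₀j : j + 1 + (l₀ : ℤ) = m := by rw [hl₀, Int.toNat_of_nonneg (by omega)]; ring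
    have hl₀L : l₀ < L := by
      have : (l₀ : ℤ) < ((m - j).toNat : ℤ) := by rw [hmj, hl₀, Int.toNat_of_nonneg (by omega)]; omega
      omega
    have hsq : S i m t ^ 2 ≤ 2 * E t := by
      have := sq_le_two_mul_partialTail S j hl₀L i t
      rwa [hl₀j] at this
    have hsq' : S i m t ^ 2 ≤ (2 * G) ^ 2 := by nlinarith [hsq, hft, hb]
    exact abs_le_of_sq_le_sq' hsq' (by positivity) |> fun h => abs_le.mpr h
  -- THE STEP
  intro t₁ ht₁ hpast
  have ht₁c : t₁ ≤ t₀ := ht₁.2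
  -- the carrier just beyond the cut on `[0, t₁]`
  have ha : ∀ x ∈ Icc 0 t₁, |S 0 (j + 1) x| ≤ 2 * G := by
    intro x hx
    have hfx := hpast x hx
    have h0L : (0 : ℕ) < L := hL1
    have hsq := sq_le_two_mul_partialTail S j h0L 0 x
    simp only [Nat.cast_zero, add_zero] at hsq
    have hsq' : S 0 (j + 1) x ^ 2 ≤ (2 * G) ^ 2 := by nlinarith [hsq, hfx]
    exact abs_le.mpr (abs_le_of_sq_le_sq' hsq' (by positivity))
  -- the derivative bound on `[0, t₁)`
  have hbound : ∀ x ∈ Ico 0 t₁, ‖fluxT ε ε₀ S j x - fluxT ε ε₀ S (j + L) x‖ ≤ D₁ + η := by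
    intro x hx
    have hxc : x ∈ Icc 0 t₀ := ⟨hx.1, hx.2.le.trans ht₁c⟩
    have hfar := hL₀ L hLL₀ x (hsub hxc)
    have hv : |S 1 j x| ≤ V := hVb x hxc
    have hax : |S 0 (j + 1) x| ≤ 2 * G := ha x ⟨hx.1, hx.2.le⟩
    have hTj : |fluxT ε ε₀ S j x| ≤ D₁ := by
      unfold fluxT
      rw [abs_mul, abs_mul, abs_mul, abs_of_nonneg hcj]
      have h3 : |S 1 j x + ε * S 0 (j + 1) x| ≤ V + ε * (2 * G) := by
        calc |S 1 j x + ε * S 0 (j + 1) x| ≤ |S 1 j x| + |ε * S 0 (j + 1) x| := abs_add_le _ _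
          _ = |S 1 j x| + ε * |S 0 (j + 1) x| := by rw [abs_mul, abs_of_nonneg hε]
          _ ≤ V + ε * (2 * G) := add_le_add hv (mul_le_mul_of_nonneg_left hax hε)
      rw [hD₁]
      have h12 : |S 1 j x| * |S 0 (j + 1) x| ≤ V * (2 * G) := mul_le_mul hv hax (abs_nonneg _) hV
      calc clock ε₀ j * |S 1 j x| * |S 0 (j + 1) x| * |S 1 j x + ε * S 0 (j + 1) x|
          = clock ε₀ j * ((|S 1 j x| * |S 0 (j + 1) x|) * |S 1 j x + ε * S 0 (j + 1) x|) := by ring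
        _ ≤ clock ε₀ j * ((V * (2 * G)) * (V + ε * (2 * G))) :=
            mul_le_mul_of_nonneg_left (mul_le_mul h12 h3 (abs_nonneg _) (by positivity)) hcj
        _ = clock ε₀ j * V * (2 * G) * (V + ε * (2 * G)) := by ring
    rw [Real.norm_eq_abs]
    calc |fluxT ε ε₀ S j x - fluxT ε ε₀ S (j + L) x| ≤ |fluxT ε ε₀ S j x| + |fluxT ε ε₀ S (j + L) x| := abs_sub _ _
      _ ≤ D₁ + η := add_le_add hTj hfar
  -- integrate on `[0, t₁]`
  have hsub₁ : Icc 0 t₁ ⊆ Icc 0 t₀ := Icc_subset_Icc le_rfl ht₁c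
  have hmvt := norm_image_sub_le_of_norm_deriv_le_segment' (fun x hx => (hEder x (hsub₁ hx)).mono hsub₁) hbound
    t₁ (right_mem_Icc.mpr ht₁.1)
  rw [Real.norm_eq_abs, sub_zero] at hmvt
  have hEt : E t₁ ≤ E 0 + (D₁ + η) * t₁ := by
    have := (abs_le.mp hmvt).2; linarith
  have hDt : (D₁ + η) * t₁ ≤ (D₁ + η) * t₀ := mul_le_mul_of_nonneg_left ht₁c (by positivity)
  show 2 * E t₁ ≤ G ^ 2 + 2 * t₀ * (D₁ + η)
  nlinarith [hEt, hDt, hE0]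

end Flow

end Summit.NavierStokesRegularity.NavierStokesRegularity.Theorems.HopTube

end
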